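import Mathlib.RingTheory.MvPolynomial.IrreducibleQuadratic
import Mathlib.RingTheory.Polynomial.UniqueFactorization
import Mathlib.Algebra.MvPolynomial.NoZeroDivisors
import Mathlib.Algebra.MvPolynomial.PDeriv
import Mathlib.LinearAlgebra.Matrix.ToLin
import Mathlib.LinearAlgebra.LinearIndependent.Lemmas
import Mathlib.Tactic
import HarnessLib

/-!
# Agrawal–Saha–Saptharishi–Saxena, *Jacobian hits circuits* (STOC 2012 / SICOMP 2016), §3:
# the certificate for depth-3 constant-transcendence-degree circuits (Lemma 3.1, Thm. 3.2) —
# val-lit p1 g3, N1 support (towards FSV Lemma 23)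

Source: M. Agrawal, C. Saha, R. Saptharishi, N. Saxena, *Jacobian hits circuits: hitting-sets,
lower bounds for depth-D occur-k formulas & depth-3 transcendence degree-k circuits*,
arXiv:1111.0582 (= STOC 2012; SIAM J. Comput. 45(4), 2016), §3 (held: `paper:arxiv-1111.0582`,
chunk p0007) and Appendix §7.2 (chunks p0017–p0018, the proofs of Lemma 3.1 and Thm. 3.2). Bib
key `AgrawalEtAl2011` (as in `ASSS16FaithfulHomomorphisms.lean`, val-lit t18).

## The printed argument (§3, p0007)

For products of linear polynomials `T_i = ∏_j ℓ_{ij}` the `k × k` Jacobian minor expands as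
eq. (1): `J_{x_k}(T_1, …, T_k) = Σ_{ℓ_1 ∈ L(T_1), …, ℓ_k ∈ L(T_k)} (T_1⋯T_k)/(ℓ_1⋯ℓ_k) · J_{x_k}(ℓ_1, …, ℓ_k)`,
a sum `H_0 = T · Σ_L α_L/(ℓ_1 ⋯ ℓ_k)` over INDEPENDENT `k`-sets of linear polynomials. Lemma 3.1
(certifying path): "there exist independent `ℓ_1, …, ℓ_k ∈ ℒ(H_0)` such that
`H_i := sim(H_{i-1}) mod ℓ_i ≠ 0`", found by the degree count "the degree of `sim(H_0)` is
`|ℒ(H_0)| - k` … by Chinese remaindering". Thm. 3.2: "If `Ψ` is a rank-`(k+1)` preserving map for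
`H_0`, then `Ψ(H_0) ≠ 0`", by reverse induction along the path.

## What is here (theorems only; no definitions, no named facts)

The two statements are merged into ONE induction on `k` over an abstract shape that is stable
under "restriction to the hyperplane `ℓ = 0`":

* data: affine forms `q_a = c_a + Σ_x v_{a,x} X_x` (`a` in a finite index set `U`; proportional and
  constant members allowed), coefficients `α_L ∈ K` on the `k`-subsets `L ⊆ U` supported on sets
  with `(v_a)_{a ∈ L}` linearly independent, and `N := Σ_L α_L ∏_{a ∈ U∖L} q_a` (`= H_0` with
  denominators cleared); an affine substitution `Ψ : X ↦ u + W Z` which is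
  **rank-`(k+1)`-preserving**: `· W` keeps every independent family of `≤ k+1` of the `v_a`
  independent (the printed "rank-`(k+1)` preserving map for `H_0`", in the form delivered by the
  Vandermonde/Gabizon–Raz map of Cor. 7.2 / FSV Lemma 23);
* **`ASSS16.aeval_affine_ne_zero_of_rankPreserving`**: `N ≠ 0 ⟹ Ψ(N) ≠ 0`.

Proof = the printed one, re-organised: (i) `exists_affine_pow_not_dvd` — the degree count gives a
form `q_{a₀}` with `q_{a₀}^e ∤ N`, `e` = number of members proportional to `q_{a₀}` (the first
element of a certifying path; `card_le_totalDegree_of_affine_pow_dvd` is the prime-power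
bookkeeping, `prime_affine` = a non-constant affine form is prime); (ii)
`pow_dvd_sum_sub_pow_mul_sum` + `sum_filter_inter_card_eq_one_eq` — modulo `q_{a₀}^e`, `N` is
`q_{a₀}^{e-1} · M` with `M` a sum of the same shape of size `k-1` over `U ∖ (class of a₀)` (the
printed `H_1 = sim(H_0) mod ℓ_1`, "a depth-3 circuit of the same nature … with one less linear
polynomial in the denominators"); (iii) the hyperplane substitutions `π` (source, kills `q_{a₀}`)
and `π'` (target, kills `Ψ(q_{a₀})`) — `aeval_proj_self`, `dvd_aeval_proj_X_sub_X`,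
`dvd_aeval_sub_self` ("replace `x_1` by `-Σ_{i≥2} c_i x_i/c_1`"); (iv) `rankPreserving_proj` — the
composite `π' ∘ Ψ` is rank-`k`-preserving for the projected forms (the printed use of the
rank-`(k+1)` property "modulo `(ℓ_1, …, ℓ_i)`"), by the two projection lemmas
`linearIndependent_insert_of_proj` / `linearIndependent_proj_of_insert`; (v) induction, and
`Ψ(q_{a₀}) ∤ Ψ(M) ⟹ Ψ(N) ≠ 0`.

Consumer: `FSV18TrdegLemma23Reduction.lean` (the Jacobian expansion eq. (1) and FSV Lemma 23 from
Lemma 52). Honest framing: a printed lemma of [ASSS16] re-proved in the kernel in support of the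
N1 row (`FSV2018_thm9`); `VP ≠ VNP` is NOT proved and nothing here is progress on it.

## References
* [AgrawalEtAl2011] Agrawal–Saha–Saptharishi–Saxena, arXiv:1111.0582, §3 (eq. (1), Lemma 3.1,
  Thm. 3.2) and §7.2 (proofs). locator: paper:arxiv-1111.0582 p0007.txt:L22–L110,
  p0017.txt:L100–L130, p0018.txt:L1–L40.
-/

noncomputable section

namespace Literature.Computability.AlgebraicComplexity

namespace ASSS16

open MvPolynomial Finset

section LinAlg

variable {K : Type*} [Field K] {ι : Type*} [DecidableEq ι] {M : Type*} [AddCommGroup M] [Module K M]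

/-- Linear independence of a family restricted to a `Finset`, as a vanishing-sums criterion over
the ambient index type. [folklore] -/
private theorem linearIndependent_finset_iff (f : ι → M) (s : Finset ι) :
    LinearIndependent K (fun a : s => f a) ↔
      ∀ g : ι → K, ∑ a ∈ s, g a • f a = 0 → ∀ a ∈ s, g a = 0 := by
  classical
  rw [Fintype.linearIndependent_iff]
  constructor
  · intro h g hg a ha
    have h1 : ∑ i : s, (fun i : s => g i) i • f i = 0 := by
      rw [← hg]
      exact Finset.sum_coe_sort s (fun a => g a • f a)
    exact h (fun i : s => g i) h1 ⟨a, ha⟩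
  · intro h g hg i
    set g' : ι → K := fun a => if ha : a ∈ s then g ⟨a, ha⟩ else 0 with hg'
    have h1 : ∑ a ∈ s, g' a • f a = 0 := by
      rw [← Finset.sum_coe_sort s (fun a => g' a • f a), ← hg]
      refine Finset.sum_congr rfl fun j _ => ?_
      simp [hg', j.2]
    have h2 := h g' h1 i i.2
    simpa [hg', i.2] using h2

/-- Projection lemma, first half: if the projections `f_a - (f_a(i₀)/w(i₀))·w` (`a ∈ s`) along
`w = f_{a₀}` are linearly independent, so is `f` on `insert a₀ s`. [folklore] -/
private theorem linearIndependent_insert_of_proj {m : ℕ} (f : ι → Fin m → K) (s : Finset ι) (a₀ : ι)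
    (ha₀ : a₀ ∉ s) (i₀ : Fin m) (hw : f a₀ i₀ ≠ 0)
    (h : LinearIndependent K (fun a : s => f a - (f a i₀ * (f a₀ i₀)⁻¹) • f a₀)) :
    LinearIndependent K (fun a : ↥(insert a₀ s) => f a) := by
  classical
  rw [linearIndependent_finset_iff (fun x => f x - (f x i₀ * (f a₀ i₀)⁻¹) • f a₀) s] at h
  rw [linearIndependent_finset_iff]
  intro g hg
  rw [Finset.sum_insert ha₀] at hg
  -- the relation restricted to `s`, and its `i₀`-coordinate
  have hs : ∑ a ∈ s, g a • f a = -(g a₀ • f a₀) := eq_neg_of_add_eq_zero_right hg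
  have hi : ∑ a ∈ s, g a * f a i₀ = -(g a₀ * f a₀ i₀) := by
    have := congrFun hs i₀
    simpa [Finset.sum_apply, Pi.smul_apply, smul_eq_mul] using this
  have hP : ∑ a ∈ s, g a • (f a - (f a i₀ * (f a₀ i₀)⁻¹) • f a₀) = 0 := by
    simp_rw [smul_sub, smul_smul]
    rw [Finset.sum_sub_distrib, ← Finset.sum_smul, hs]
    have e : ∑ a ∈ s, g a * (f a i₀ * (f a₀ i₀)⁻¹) = -(g a₀) := by
      simp_rw [← mul_assoc]
      rw [← Finset.sum_mul, hi]
      field_simp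
    rw [e]
    simp
  have hgs : ∀ a ∈ s, g a = 0 := h g hP
  have hg0 : g a₀ = 0 := by
    have h1 : ∑ a ∈ s, g a • f a = 0 := Finset.sum_eq_zero fun a ha => by rw [hgs a ha, zero_smul]
    rw [h1, add_zero] at hg
    rcases smul_eq_zero.1 hg with h2 | h2
    · exact h2
    · exact absurd (congrFun h2 i₀) hw
  intro a ha
  rcases Finset.mem_insert.1 ha with rfl | ha
  · exact hg0
  · exact hgs a ha

/-- Projection lemma, second half: if `f` is linearly independent on `insert b s` with
`f_b = t·w` (`t ≠ 0`), the projections `f_a - (f_a(i₀)/w(i₀))·w` (`a ∈ s`) along `w` are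
linearly independent. [folklore] -/
private theorem linearIndependent_proj_of_insert {m : ℕ} (f : ι → Fin m → K) (w : Fin m → K)
    (s : Finset ι) (b : ι) (hb : b ∉ s) (i₀ : Fin m) (t : K) (ht : t ≠ 0)
    (hfb : f b = t • w) (h : LinearIndependent K (fun a : ↥(insert b s) => f a)) :
    LinearIndependent K (fun a : s => f a - (f a i₀ * (w i₀)⁻¹) • w) := by
  classical
  rw [linearIndependent_finset_iff] at h
  rw [linearIndependent_finset_iff (fun x => f x - (f x i₀ * (w i₀)⁻¹) • w) s]
  intro g hg
  set lam : K := ∑ a ∈ s, g a * (f a i₀ * (w i₀)⁻¹) with hlam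
  have hrel : ∑ a ∈ s, g a • f a - lam • w = 0 := by
    rw [hlam, Finset.sum_smul, ← Finset.sum_sub_distrib]
    simpa only [smul_sub, smul_smul] using hg
  set g' : ι → K := fun a => if a = b then -(lam * t⁻¹) else g a with hg'
  have hsum : ∑ a ∈ insert b s, g' a • f a = 0 := by
    rw [Finset.sum_insert hb]
    have e1 : g' b • f b = -(lam • w) := by
      have hb' : g' b = -(lam * t⁻¹) := by simp [hg']
      rw [hb', hfb, smul_smul, neg_mul, neg_smul, mul_assoc, inv_mul_cancel₀ ht, mul_one]
    have e2 : ∑ a ∈ s, g' a • f a = ∑ a ∈ s, g a • f a := by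
      refine Finset.sum_congr rfl fun a ha => ?_
      have hab : a ≠ b := fun h => hb (h ▸ ha)
      have : g' a = g a := by simp [hg', hab]
      rw [this]
    rw [e1, e2, ← sub_eq_zero.1 hrel]
    abel
  have hz := h g' hsum
  intro a ha
  have hab : a ≠ b := fun h => hb (h ▸ ha)
  have := hz a (Finset.mem_insert_of_mem ha)
  simpa [hg', hab] using this

end LinAlg

section AffineForms

variable {K : Type*} [Field K] {n : ℕ}

/-- Constant coefficient of the affine form `c + Σ_x v_x X_x`. [folklore] -/
private theorem coeff_zero_affine (c : K) (v : Fin n → K) :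
    coeff 0 (C c + ∑ x, C (v x) * X x : MvPolynomial (Fin n) K) = c := by
  classical
  rw [coeff_add, coeff_C, if_pos rfl, coeff_sum, Finset.sum_eq_zero, add_zero]
  intro x _
  rw [coeff_C_mul, coeff_X, if_neg, mul_zero]
  exact fun h => one_ne_zero (Finsupp.single_eq_zero.1 h)

/-- Degree-one coefficients of the affine form `c + Σ_x v_x X_x`. [folklore] -/
private theorem coeff_single_affine (c : K) (v : Fin n → K) (j : Fin n) :
    coeff (Finsupp.single j 1) (C c + ∑ x, C (v x) * X x : MvPolynomial (Fin n) K) = v j := by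
  classical
  rw [coeff_add, coeff_C, if_neg (Finsupp.single_ne_zero.2 one_ne_zero).symm, zero_add, coeff_sum,
    Finset.sum_eq_single j]
  · rw [coeff_C_mul, coeff_X, if_pos rfl, mul_one]
  · intro x _ hx
    rw [coeff_C_mul, coeff_X, if_neg, mul_zero]
    intro h
    exact hx ((Finsupp.single_left_inj (one_ne_zero)).1 h)
  · intro h
    exact absurd (Finset.mem_univ j) h

/-- An affine form vanishes only if all its coefficients do. [folklore] -/
private theorem affine_eq_zero_iff (c : K) (v : Fin n → K) :
    (C c + ∑ x, C (v x) * X x : MvPolynomial (Fin n) K) = 0 ↔ c = 0 ∧ v = 0 := by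
  constructor
  · intro h
    refine ⟨?_, funext fun j => ?_⟩
    · have := congrArg (coeff 0) h
      rwa [coeff_zero_affine, coeff_zero] at this
    · have := congrArg (coeff (Finsupp.single j 1)) h
      rwa [coeff_single_affine, coeff_zero] at this
  · rintro ⟨rfl, rfl⟩
    simp

/-- An affine form has total degree `≤ 1`. [folklore] -/
private theorem totalDegree_affine_le (c : K) (v : Fin n → K) :
    (C c + ∑ x, C (v x) * X x : MvPolynomial (Fin n) K).totalDegree ≤ 1 := by
  refine (totalDegree_add _ _).trans (max_le ?_ ?_)
  · rw [totalDegree_C]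
    exact Nat.zero_le _
  · refine (totalDegree_finsetSum _ _).trans (Finset.sup_le fun x _ => ?_)
    refine (totalDegree_mul _ _).trans ?_
    rw [totalDegree_C, totalDegree_X, zero_add]

/-- A non-constant affine form has total degree exactly `1`. [folklore] -/
private theorem totalDegree_affine_eq_one (c : K) {v : Fin n → K} (hv : v ≠ 0) :
    (C c + ∑ x, C (v x) * X x : MvPolynomial (Fin n) K).totalDegree = 1 := by
  refine le_antisymm (totalDegree_affine_le c v) ?_
  obtain ⟨j, hj⟩ : ∃ j, v j ≠ 0 := Function.ne_iff.1 hv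
  have hmem : Finsupp.single j 1 ∈ (C c + ∑ x, C (v x) * X x : MvPolynomial (Fin n) K).support := by
    rw [mem_support_iff, coeff_single_affine]
    exact hj
  have := le_totalDegree hmem
  simpa using this

/-- A non-constant affine form over a field is prime in `K[x_1, …, x_n]` (irreducible of total
degree one, `MvPolynomial.irreducible_of_totalDegree_eq_one`, in a UFD). [folklore] -/
private theorem prime_affine (c : K) {v : Fin n → K} (hv : v ≠ 0) :
    Prime (C c + ∑ x, C (v x) * X x : MvPolynomial (Fin n) K) := by
  refine (irreducible_of_totalDegree_eq_one (totalDegree_affine_eq_one c hv) fun x hx => ?_).prime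
  obtain ⟨j, hj⟩ : ∃ j, v j ≠ 0 := Function.ne_iff.1 hv
  have h1 := hx (Finsupp.single j 1)
  rw [coeff_single_affine] at h1
  have hx0 : x ≠ 0 := by
    rintro rfl
    exact hj (zero_dvd_iff.1 h1)
  exact isUnit_iff_ne_zero.2 hx0

/-- Divisibility between non-constant affine forms means proportionality. [folklore] -/
private theorem exists_eq_smul_of_affine_dvd (c c' : K) {v v' : Fin n → K} (hv : v ≠ 0) (hv' : v' ≠ 0)
    (h : (C c + ∑ x, C (v x) * X x : MvPolynomial (Fin n) K) ∣ (C c' + ∑ x, C (v' x) * X x)) :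
    ∃ t : K, t ≠ 0 ∧ c' = t * c ∧ v' = t • v := by
  obtain ⟨r, hr⟩ := h
  have hq' : (C c' + ∑ x, C (v' x) * X x : MvPolynomial (Fin n) K) ≠ 0 := fun h0 =>
    hv' ((affine_eq_zero_iff c' v').1 h0).2
  have hq : (C c + ∑ x, C (v x) * X x : MvPolynomial (Fin n) K) ≠ 0 := fun h0 =>
    hv ((affine_eq_zero_iff c v).1 h0).2
  have hr0 : r ≠ 0 := by
    rintro rfl
    exact hq' (by rw [hr, mul_zero])
  have hdeg : r.totalDegree = 0 := by
    have h1 := congrArg totalDegree hr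
    rw [totalDegree_mul_of_isDomain hq hr0, totalDegree_affine_eq_one c' hv',
      totalDegree_affine_eq_one c hv] at h1
    omega
  obtain ⟨t, rfl⟩ : ∃ t, r = C t := ⟨coeff 0 r, (totalDegree_eq_zero_iff_eq_C).1 hdeg⟩
  have ht : t ≠ 0 := fun h0 => hr0 (by rw [h0, C_0])
  refine ⟨t, ht, ?_, funext fun j => ?_⟩
  · have := congrArg (coeff 0) hr
    rwa [coeff_zero_affine, mul_comm, coeff_C_mul, coeff_zero_affine] at this
  · have := congrArg (coeff (Finsupp.single j 1)) hr
    rwa [coeff_single_affine, mul_comm, coeff_C_mul, coeff_single_affine] at this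

/-- Partial derivatives of an affine form are its degree-one coefficients (the computation
`∂ℓ_{ij}/∂x` behind eq. (1): "`∂T_i/∂x = T_i · (Σ_j (∂ℓ_{ij}/∂x)/ℓ_{ij})`").
[cite: AgrawalEtAl2011, §3 (eq. (1))] locator: paper:arxiv-1111.0582 p0007.txt:L24–L26 -/
theorem pderiv_affine (c : K) (v : Fin n → K) (j : Fin n) :
    pderiv j (C c + ∑ x, C (v x) * X x : MvPolynomial (Fin n) K) = C (v j) := by
  classical
  rw [map_add, pderiv_C, zero_add, map_sum, Finset.sum_eq_single j]
  · rw [pderiv_C_mul, pderiv_X_self, mul_one]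
  · intro x _ hx
    rw [pderiv_C_mul, pderiv_X_of_ne hx, mul_zero]
  · intro h
    exact absurd (Finset.mem_univ j) h

/-- **Affine substitutions act on affine forms by matrix multiplication:** under
`X_x ↦ u_x + Σ_b W_{x b} Z_b`, the form `c + Σ_x v_x X_x` becomes `(c + v·u) + Σ_b (v W)_b Z_b`.
[folklore] -/
private theorem aeval_affine_affine {m : ℕ} (u : Fin n → K) (W : Matrix (Fin n) (Fin m) K) (c : K)
    (v : Fin n → K) :
    aeval (fun x : Fin n => (C (u x) + ∑ b, C (W x b) * X b : MvPolynomial (Fin m) K))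
        (C c + ∑ x, C (v x) * X x : MvPolynomial (Fin n) K) =
      C (c + v ⬝ᵥ u) + ∑ b, C (Matrix.vecMul v W b) * X b := by
  rw [map_add, aeval_C, algebraMap_eq, map_sum]
  simp_rw [map_mul, aeval_C, algebraMap_eq, aeval_X, mul_add, Finset.sum_add_distrib, Finset.mul_sum]
  have h1 : ∑ x, C (v x) * C (u x) = (C (v ⬝ᵥ u) : MvPolynomial (Fin m) K) := by
    rw [dotProduct, map_sum]
    simp_rw [map_mul]
  have h2 : ∑ x, ∑ b, C (v x) * (C (W x b) * X b) =
      ∑ b, (C (Matrix.vecMul v W b) * X b : MvPolynomial (Fin m) K) := by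
    rw [Finset.sum_comm]
    refine Finset.sum_congr rfl fun b _ => ?_
    rw [Matrix.vecMul, dotProduct, map_sum, Finset.sum_mul]
    refine Finset.sum_congr rfl fun x _ => ?_
    rw [map_mul, mul_assoc]
  rw [h1, h2, map_add, add_assoc]

end AffineForms

section Combinatorics

variable {R : Type*} [CommRing R] {ι : Type*} [DecidableEq ι]

/-- **The residue decomposition** behind the certifying path of [ASSS16, Lemma 3.1]: if the members
`q_a`, `a ∈ I ⊆ U`, are the multiples `t_a · q₀` of one form and no coefficient `α_L` survives on
sets `L` meeting `I` twice, then modulo `q₀^{|I|}` the sum `Σ_L α_L ∏_{a ∈ U∖L} q_a` over the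
`(k+1)`-subsets of `U` is `q₀^{|I|-1}` times the corresponding sum for `U ∖ I` collecting the
sets that meet `I` exactly once. [cite: AgrawalEtAl2011, Lemma 3.1 (proof, §7.2)]
locator: paper:arxiv-1111.0582 p0017.txt (Lemma `lem:path-cert-rational-sum`) -/
theorem pow_dvd_sum_sub_pow_mul_sum (U I : Finset ι) (k : ℕ) (q : ι → R) (q₀ : R) (t : ι → R)
    (α : Finset ι → R) (hI : I ⊆ U) (hq : ∀ a ∈ I, q a = t a * q₀)
    (hα : ∀ L ∈ U.powersetCard (k + 1), 2 ≤ (L ∩ I).card → α L = 0) (he : 1 ≤ I.card) :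
    q₀ ^ I.card ∣
      (∑ L ∈ U.powersetCard (k + 1), α L * ∏ a ∈ U \ L, q a) -
        q₀ ^ (I.card - 1) *
          ∑ L ∈ (U.powersetCard (k + 1)).filter (fun L => (L ∩ I).card = 1),
            (α L * ∏ a ∈ I \ L, t a) * ∏ a ∈ (U \ I) \ L, q a := by
  rw [Finset.sum_filter, Finset.mul_sum, ← Finset.sum_sub_distrib]
  refine Finset.dvd_sum fun L hL => ?_
  have hLU : L ⊆ U := (Finset.mem_powersetCard.1 hL).1
  -- the product over `I \ L`
  have hprodI : ∏ a ∈ I \ L, q a = (∏ a ∈ I \ L, t a) * q₀ ^ (I \ L).card := by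
    rw [← Finset.prod_const, ← Finset.prod_mul_distrib]
    exact Finset.prod_congr rfl fun a ha => hq a (Finset.mem_sdiff.1 ha).1
  have hsplit : ∏ a ∈ U \ L, q a = (∏ a ∈ (U \ I) \ L, q a) * ∏ a ∈ I \ L, q a := by
    have hsub : I \ L ⊆ U \ L := Finset.sdiff_subset_sdiff hI le_rfl
    rw [← Finset.prod_sdiff hsub]
    congr 1
    refine Finset.prod_congr ?_ fun _ _ => rfl
    ext a
    simp only [Finset.mem_sdiff]
    tauto
  have hcard : (I \ L).card + (L ∩ I).card = I.card := by
    rw [Finset.inter_comm]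
    exact Finset.card_sdiff_add_card_inter I L
  rcases Nat.lt_or_ge (L ∩ I).card 1 with h0 | h1
  · -- `L ∩ I = ∅`
    have h0' : (L ∩ I).card = 0 := by omega
    rw [if_neg (by omega), mul_zero, sub_zero, hsplit, hprodI, (by omega : (I \ L).card = I.card)]
    exact ⟨α L * (∏ a ∈ (U \ I) \ L, q a) * ∏ a ∈ I \ L, t a, by ring⟩
  rcases Nat.lt_or_ge (L ∩ I).card 2 with h1' | h2
  · -- `|L ∩ I| = 1`
    have h1e : (L ∩ I).card = 1 := by omega
    rw [if_pos h1e, hsplit, hprodI, (by omega : (I \ L).card = I.card - 1)]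
    exact Dvd.intro 0 (by ring)
  · -- `|L ∩ I| ≥ 2`
    rw [hα L hL h2]
    simp

/-- Re-indexing the once-meeting sets `L` by `L' = L ∖ I ⊆ U ∖ I` (a `k`-subset): the collected
sum is again of the shape `Σ_{L'} β_{L'} ∏_{a ∈ (U∖I)∖L'} q_a`. [folklore] -/
private theorem sum_filter_inter_card_eq_one_eq (U I : Finset ι) (k : ℕ) (q : ι → R) (γ : Finset ι → R) :
    ∑ L ∈ (U.powersetCard (k + 1)).filter (fun L => (L ∩ I).card = 1), γ L * ∏ a ∈ (U \ I) \ L, q a =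
      ∑ L' ∈ (U \ I).powersetCard k,
        (∑ L ∈ ((U.powersetCard (k + 1)).filter (fun L => (L ∩ I).card = 1)).filter
            (fun L => L \ I = L'), γ L) * ∏ a ∈ (U \ I) \ L', q a := by
  have hmaps : ∀ L ∈ (U.powersetCard (k + 1)).filter (fun L => (L ∩ I).card = 1),
      L \ I ∈ (U \ I).powersetCard k := by
    intro L hL
    rw [Finset.mem_filter, Finset.mem_powersetCard] at hL
    rw [Finset.mem_powersetCard]
    refine ⟨Finset.sdiff_subset_sdiff hL.1.1 le_rfl, ?_⟩
    have := Finset.card_sdiff_add_card_inter L I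
    omega
  rw [← Finset.sum_fiberwise_of_maps_to hmaps]
  refine Finset.sum_congr rfl fun L' _ => ?_
  rw [Finset.sum_mul]
  refine Finset.sum_congr rfl fun L hL => ?_
  rw [Finset.mem_filter] at hL
  congr 1
  refine Finset.prod_congr ?_ fun _ _ => rfl
  rw [← hL.2]
  ext a
  simp only [Finset.mem_sdiff]
  tauto

end Combinatorics

section Congruence

variable {K : Type*} [CommRing K] {σ : Type*}

/-- An algebra endomorphism that moves every variable within its class modulo `q` moves every
polynomial within its class modulo `q` ("we can replace `x_1` by `-Σ_{i≥2} c_i x_i / c_1` …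
modulo `ℓ_1`"). [cite: AgrawalEtAl2011, §3 (definition of `H_1 = sim(H_0) mod ℓ_1`)]
locator: paper:arxiv-1111.0582 p0007.txt -/
theorem dvd_aeval_sub_self (g : σ → MvPolynomial σ K) (q : MvPolynomial σ K)
    (hg : ∀ x, q ∣ g x - X x) (G : MvPolynomial σ K) : q ∣ aeval g G - G := by
  induction G using MvPolynomial.induction_on with
  | C a =>
    rw [aeval_C, algebraMap_eq, sub_self]
    exact dvd_zero q
  | add p p' hp hp' =>
    have e : aeval g (p + p') - (p + p') = (aeval g p - p) + (aeval g p' - p') := by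
      rw [map_add]; ring
    rw [e]
    exact dvd_add hp hp'
  | mul_X p x hp =>
    have e : aeval g (p * X x) - p * X x = (aeval g p - p) * g x + p * (g x - X x) := by
      rw [map_mul, aeval_X]; ring
    rw [e]
    exact dvd_add (dvd_mul_of_dvd_left hp _) (dvd_mul_of_dvd_right (hg x) _)

end Congruence

section Degree

variable {K : Type*} [Field K] {ι : Type*} {n : ℕ}

/-- Proportionality of affine forms (`q_b = t · q_a`, `t ≠ 0`) is symmetric. [folklore] -/
private theorem affineAssoc_symm {c : ι → K} {v : ι → Fin n → K} {a b : ι}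
    (h : ∃ t : K, t ≠ 0 ∧ c b = t * c a ∧ v b = t • v a) :
    ∃ t : K, t ≠ 0 ∧ c a = t * c b ∧ v a = t • v b := by
  obtain ⟨t, ht, hc, hv⟩ := h
  refine ⟨t⁻¹, inv_ne_zero ht, ?_, ?_⟩
  · rw [hc, ← mul_assoc, inv_mul_cancel₀ ht, one_mul]
  · rw [hv, smul_smul, inv_mul_cancel₀ ht, one_smul]

/-- Proportionality of affine forms is transitive. [folklore] -/
private theorem affineAssoc_trans {c : ι → K} {v : ι → Fin n → K} {a b d : ι}
    (h : ∃ t : K, t ≠ 0 ∧ c b = t * c a ∧ v b = t • v a)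
    (h' : ∃ t : K, t ≠ 0 ∧ c d = t * c b ∧ v d = t • v b) :
    ∃ t : K, t ≠ 0 ∧ c d = t * c a ∧ v d = t • v a := by
  obtain ⟨t, ht, hc, hv⟩ := h
  obtain ⟨t', ht', hc', hv'⟩ := h'
  refine ⟨t' * t, mul_ne_zero ht' ht, ?_, ?_⟩
  · rw [hc', hc, mul_assoc]
  · rw [hv', hv, smul_smul]

/-- Powers of a non-constant affine form have the expected total degree. [folklore] -/
private theorem totalDegree_affine_pow (c : K) {v : Fin n → K} (hv : v ≠ 0) (e : ℕ) :
    ((C c + ∑ x, C (v x) * X x : MvPolynomial (Fin n) K) ^ e).totalDegree = e := by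
  have hq : (C c + ∑ x, C (v x) * X x : MvPolynomial (Fin n) K) ≠ 0 := fun h0 =>
    hv ((affine_eq_zero_iff c v).1 h0).2
  induction e with
  | zero => simp
  | succ e ih =>
    rw [pow_succ, totalDegree_mul_of_isDomain (pow_ne_zero _ hq) hq, ih,
      totalDegree_affine_eq_one c hv]

/-- **Degree count for the prime-power argument** ("the degree of `sim(H_0)` is `|ℒ(H_0)| - k` …
by Chinese remaindering there exists `ℓ_1 ∈ ℒ(H_0)` such that `H_1 := sim(H_0) mod ℓ_1 ≠ 0`",
[ASSS16, proof of Lemma 3.1]): if every non-constant form `q_a`, `a ∈ S`, divides `G ≠ 0` to the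
power of the number of its proportional copies in `U` (`S` closed under proportionality among the
non-constant members of `U`), then `|S| ≤ deg G`. [cite: AgrawalEtAl2011, Lemma 3.1 (proof, §7.2)]
locator: paper:arxiv-1111.0582 p0017.txt -/
theorem card_le_totalDegree_of_affine_pow_dvd [DecidableEq ι] (U : Finset ι) (c : ι → K)
    (v : ι → Fin n → K) :
    ∀ (m : ℕ) (S : Finset ι), S.card = m → (∀ a ∈ S, a ∈ U ∧ v a ≠ 0) →
      (∀ a ∈ S, ∀ b ∈ U, (∃ t : K, t ≠ 0 ∧ c b = t * c a ∧ v b = t • v a) → b ∈ S) →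
      ∀ G : MvPolynomial (Fin n) K, G ≠ 0 →
        (∀ a ∈ S, ∀ I : Finset ι, (∀ b, b ∈ I ↔ b ∈ U ∧ ∃ t : K, t ≠ 0 ∧ c b = t * c a ∧ v b = t • v a) →
          (C (c a) + ∑ x, C (v a x) * X x : MvPolynomial (Fin n) K) ^ I.card ∣ G) →
        S.card ≤ G.totalDegree := by
  classical
  intro m
  induction m using Nat.strong_induction_on with
  | _ m ih =>
  intro S hSm hSU hclosed G hG hdvd
  rcases S.eq_empty_or_nonempty with rfl | ⟨a, ha⟩
  · simp
  -- the class `I` of `a`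
  set I := U.filter fun b => ∃ t : K, t ≠ 0 ∧ c b = t * c a ∧ v b = t • v a with hIdef
  have hImem : ∀ b, b ∈ I ↔ b ∈ U ∧ ∃ t : K, t ≠ 0 ∧ c b = t * c a ∧ v b = t • v a := fun b =>
    Finset.mem_filter
  have haU : a ∈ U := (hSU a ha).1
  have hva : v a ≠ 0 := (hSU a ha).2
  have haI : a ∈ I := (hImem a).2 ⟨haU, 1, one_ne_zero, by simp, by simp⟩
  have hIS : I ⊆ S := fun b hb => hclosed a ha b ((hImem b).1 hb).1 ((hImem b).1 hb).2
  -- `G = q_a^e · G''`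
  obtain ⟨G'', hG''⟩ := hdvd a ha I hImem
  set qa : MvPolynomial (Fin n) K := C (c a) + ∑ x, C (v a x) * X x with hqa
  have hqa0 : qa ≠ 0 := fun h0 => hva ((affine_eq_zero_iff (c a) (v a)).1 h0).2
  have hG''0 : G'' ≠ 0 := by
    rintro rfl
    exact hG (by rw [hG'', mul_zero])
  have hdegG : G.totalDegree = I.card + G''.totalDegree := by
    rw [hG'', totalDegree_mul_of_isDomain (pow_ne_zero _ hqa0) hG''0, hqa,
      totalDegree_affine_pow (c a) hva]
  -- the smaller closed set `S \ I`
  set S' := S \ I with hS'def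
  have hS'card : S'.card = S.card - I.card := Finset.card_sdiff_of_subset hIS
  have hlt : S'.card < m := by
    have h1 := Finset.card_le_card hIS
    have h2 : 1 ≤ I.card := Finset.card_pos.2 ⟨a, haI⟩
    omega
  have hS'U : ∀ b ∈ S', b ∈ U ∧ v b ≠ 0 := fun b hb => hSU b (Finset.mem_sdiff.1 hb).1
  have hS'closed : ∀ b ∈ S', ∀ b' ∈ U,
      (∃ t : K, t ≠ 0 ∧ c b' = t * c b ∧ v b' = t • v b) → b' ∈ S' := by
    intro b hb b' hb'U hbb'
    have hb'S : b' ∈ S := hclosed b (Finset.mem_sdiff.1 hb).1 b' hb'U hbb'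
    refine Finset.mem_sdiff.2 ⟨hb'S, fun hb'I => (Finset.mem_sdiff.1 hb).2 ?_⟩
    have hab' : ∃ t : K, t ≠ 0 ∧ c b' = t * c a ∧ v b' = t • v a := ((hImem b').1 hb'I).2
    exact (hImem b).2 ⟨(hSU b (Finset.mem_sdiff.1 hb).1).1,
      affineAssoc_trans hab' (affineAssoc_symm hbb')⟩
  have hdvd' : ∀ b ∈ S', ∀ I' : Finset ι,
      (∀ b', b' ∈ I' ↔ b' ∈ U ∧ ∃ t : K, t ≠ 0 ∧ c b' = t * c b ∧ v b' = t • v b) →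
      (C (c b) + ∑ x, C (v b x) * X x : MvPolynomial (Fin n) K) ^ I'.card ∣ G'' := by
    intro b hb I' hI'
    have hbS : b ∈ S := (Finset.mem_sdiff.1 hb).1
    have hvb : v b ≠ 0 := (hSU b hbS).2
    have hprime := prime_affine (c b) hvb
    have hndvd : ¬ (C (c b) + ∑ x, C (v b x) * X x : MvPolynomial (Fin n) K) ∣ qa ^ I.card := by
      intro h
      have h1 := hprime.dvd_of_dvd_pow h
      obtain ⟨t, ht, hc, hv⟩ := exists_eq_smul_of_affine_dvd (c b) (c a) hvb hva h1
      -- so `b` is proportional to `a`, i.e. `b ∈ I`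
      exact (Finset.mem_sdiff.1 hb).2 ((hImem b).2
        ⟨(hSU b hbS).1, affineAssoc_symm ⟨t, ht, hc, hv⟩⟩)
    have h2 := hdvd b hbS I' hI'
    rw [hG''] at h2
    exact hprime.pow_dvd_of_dvd_mul_left _ hndvd h2
  have hih := ih S'.card hlt S' rfl hS'U hS'closed G'' hG''0 hdvd'
  rw [hdegG]
  have := Finset.card_le_card hIS
  omega

/-- **Some non-constant form occurs in `G` below its multiplicity** (the existence of the first
element of a certifying path, [ASSS16, Lemma 3.1]): if `G ≠ 0` has total degree below the number
of non-constant forms in `U`, some `q_{a₀}^{e} ∤ G`, `e` = the number of forms of `U`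
proportional to `q_{a₀}`. [cite: AgrawalEtAl2011, Lemma 3.1 (proof, §7.2)]
locator: paper:arxiv-1111.0582 p0017.txt -/
theorem exists_affine_pow_not_dvd [DecidableEq ι] (U : Finset ι) (c : ι → K) (v : ι → Fin n → K)
    (NC : Finset ι) (hNC : ∀ a, a ∈ NC ↔ a ∈ U ∧ v a ≠ 0)
    (G : MvPolynomial (Fin n) K) (hG : G ≠ 0) (hdeg : G.totalDegree < NC.card) :
    ∃ a₀ ∈ U, v a₀ ≠ 0 ∧ ∃ I : Finset ι,
      (∀ b, b ∈ I ↔ b ∈ U ∧ ∃ t : K, t ≠ 0 ∧ c b = t * c a₀ ∧ v b = t • v a₀) ∧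
      ¬ ((C (c a₀) + ∑ x, C (v a₀ x) * X x : MvPolynomial (Fin n) K) ^ I.card ∣ G) := by
  classical
  by_contra hcon
  have hall : ∀ a ∈ NC, ∀ I : Finset ι,
      (∀ b, b ∈ I ↔ b ∈ U ∧ ∃ t : K, t ≠ 0 ∧ c b = t * c a ∧ v b = t • v a) →
      (C (c a) + ∑ x, C (v a x) * X x : MvPolynomial (Fin n) K) ^ I.card ∣ G := by
    intro a ha I hI
    by_contra h
    exact hcon ⟨a, ((hNC a).1 ha).1, ((hNC a).1 ha).2, I, hI, h⟩
  have hclosed : ∀ a ∈ NC, ∀ b ∈ U,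
      (∃ t : K, t ≠ 0 ∧ c b = t * c a ∧ v b = t • v a) → b ∈ NC := by
    rintro a ha b hb ⟨t, ht, -, hv⟩
    refine (hNC b).2 ⟨hb, ?_⟩
    rw [hv]
    exact smul_ne_zero ht ((hNC a).1 ha).2
  have := card_le_totalDegree_of_affine_pow_dvd U c v _ NC rfl (fun a ha => (hNC a).1 ha)
    hclosed G hG hall
  omega

end Degree

section Projection

variable {K : Type*} [Field K] {m : ℕ}

/-- The hom part of the hyperplane substitution `Z_{i₀} ↦ Z_{i₀} - q₁/w_{i₀}` is the projection
along `w` onto `{z | z_{i₀} = 0}`. [folklore] -/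
private theorem vecMul_projMatrix (w : Fin m → K) (i₀ : Fin m) (z : Fin m → K) :
    Matrix.vecMul z (Matrix.of fun y y' : Fin m =>
        (if y = y' then (1 : K) else 0) - (if y = i₀ then (w i₀)⁻¹ * w y' else 0)) =
      z - (z i₀ * (w i₀)⁻¹) • w := by
  funext y'
  simp only [Matrix.vecMul, dotProduct, Matrix.of_apply, mul_sub, Finset.sum_sub_distrib,
    mul_ite, mul_one, mul_zero, Finset.sum_ite_eq', Finset.mem_univ, if_true,
    Pi.sub_apply, Pi.smul_apply, smul_eq_mul]
  ring

/-- The constant part of the hyperplane substitution. [folklore] -/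
private theorem dotProduct_projVec (w : Fin m → K) (i₀ : Fin m) (c₁ : K) (z : Fin m → K) :
    z ⬝ᵥ (fun y : Fin m => if y = i₀ then -((w i₀)⁻¹ * c₁) else 0) = -(z i₀ * (w i₀)⁻¹ * c₁) := by
  simp only [dotProduct, mul_ite, mul_zero, Finset.sum_ite_eq', Finset.mem_univ, if_true]
  ring

/-- The hyperplane substitution kills the form `q₁ = c₁ + Σ w_y Z_y` it is built from.
[folklore] -/
private theorem aeval_proj_self (w : Fin m → K) (i₀ : Fin m) (hw : w i₀ ≠ 0) (c₁ : K) :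
    aeval (fun y : Fin m => (C (if y = i₀ then -((w i₀)⁻¹ * c₁) else 0) +
        ∑ y', C ((Matrix.of fun y y' : Fin m =>
          (if y = y' then (1 : K) else 0) - (if y = i₀ then (w i₀)⁻¹ * w y' else 0)) y y') * X y' :
            MvPolynomial (Fin m) K))
      (C c₁ + ∑ y, C (w y) * X y : MvPolynomial (Fin m) K) = 0 := by
  rw [aeval_affine_affine, vecMul_projMatrix, dotProduct_projVec, affine_eq_zero_iff]
  constructor
  · field_simp
    ring
  · funext y
    simp [hw]

/-- The hyperplane substitution moves each variable within its class modulo `q₁`. [folklore] -/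
private theorem dvd_aeval_proj_X_sub_X (w : Fin m → K) (i₀ : Fin m) (c₁ : K) (y : Fin m) :
    (C c₁ + ∑ y', C (w y') * X y' : MvPolynomial (Fin m) K) ∣
      (C (if y = i₀ then -((w i₀)⁻¹ * c₁) else 0) +
        ∑ y', C ((Matrix.of fun y y' : Fin m =>
          (if y = y' then (1 : K) else 0) - (if y = i₀ then (w i₀)⁻¹ * w y' else 0)) y y') * X y' :
            MvPolynomial (Fin m) K) - X y := by
  by_cases hy : y = i₀
  · subst hy
    refine ⟨-C ((w y)⁻¹), ?_⟩
    simp only [Matrix.of_apply, if_true, map_sub, map_neg, map_mul, sub_mul, Finset.sum_sub_distrib]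
    have h1 : ∑ x, C (if y = x then (1 : K) else 0) * X x = (X y : MvPolynomial (Fin m) K) := by
      simp_rw [apply_ite C, map_one, map_zero, ite_mul, one_mul, zero_mul]
      rw [Finset.sum_ite_eq]
      simp
    rw [h1, add_mul, Finset.sum_mul]
    have h2 : ∑ x, C (w x) * X x * -C (w y)⁻¹ =
        -∑ x, (C (w y)⁻¹ * C (w x) * X x : MvPolynomial (Fin m) K) := by
      rw [← Finset.sum_neg_distrib]
      exact Finset.sum_congr rfl fun x _ => by ring
    rw [h2]
    ring
  · refine ⟨0, ?_⟩
    simp only [Matrix.of_apply, if_neg hy, map_zero, zero_add, sub_zero, mul_zero]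
    simp_rw [apply_ite C, map_one, map_zero, ite_mul, one_mul, zero_mul]
    rw [Finset.sum_ite_eq]
    simp

/-- Composition of affine substitutions is the affine substitution with multiplied matrices.
[folklore] -/
private theorem aeval_affine_comp {n p : ℕ} (u₁ : Fin n → K) (W₁ : Matrix (Fin n) (Fin m) K)
    (u₂ : Fin m → K) (W₂ : Matrix (Fin m) (Fin p) K) (G : MvPolynomial (Fin n) K) :
    aeval (fun y : Fin m => (C (u₂ y) + ∑ z, C (W₂ y z) * X z : MvPolynomial (Fin p) K))
        (aeval (fun x : Fin n => (C (u₁ x) + ∑ y, C (W₁ x y) * X y : MvPolynomial (Fin m) K)) G) =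
      aeval (fun x : Fin n => (C ((u₁ + Matrix.mulVec W₁ u₂) x) +
        ∑ z, C ((W₁ * W₂) x z) * X z : MvPolynomial (Fin p) K)) G := by
  rw [← AlgHom.comp_apply]
  congr 1
  refine algHom_ext fun x => ?_
  rw [AlgHom.comp_apply, aeval_X, aeval_X, aeval_affine_affine (u₂) (W₂) (u₁ x) (fun y => W₁ x y)]
  simp [Matrix.mulVec, Matrix.mul_apply, Matrix.vecMul, dotProduct]

end Projection

section Transfer

variable {K : Type*} [Field K] {ι : Type*} [DecidableEq ι] {n μ : ℕ}

/-- Two proportional members in `L` make the family linearly dependent ("the term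
`J(ℓ_1, …, ℓ_k)` ensures that the sum is only over independent `ℓ_1, …, ℓ_k`").
[cite: AgrawalEtAl2011, §3 (after eq. (1))] locator: paper:arxiv-1111.0582 p0007.txt -/
theorem not_linearIndependent_of_two_smul (v : ι → Fin n → K) (w : Fin n → K) (L : Finset ι)
    {b b' : ι} (hb : b ∈ L) (hb' : b' ∈ L) (hne : b ≠ b') {t t' : K} (ht' : t' ≠ 0)
    (hvb : v b = t • w) (hvb' : v b' = t' • w) : ¬ LinearIndependent K (fun a : L => v a) := by
  rw [linearIndependent_finset_iff]
  intro h
  set g : ι → K := fun x => if x = b then t' else if x = b' then -t else 0 with hg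
  have hsum : ∑ x ∈ L, g x • v x = 0 := by
    rw [Finset.sum_eq_add_of_mem b b' hb hb' hne]
    · have e1 : g b = t' := by simp [hg]
      have e2 : g b' = -t := by simp [hg, hne.symm]
      rw [e1, e2, hvb, hvb', smul_smul, smul_smul, ← add_smul]
      ring_nf
      simp
    · intro x _ hx
      have e : g x = 0 := by simp [hg, hx.1, hx.2]
      rw [e, zero_smul]
  have := h g hsum b hb
  simp [hg] at this
  exact ht' this

/-- Support transfer for the collected coefficients: a linearly independent `(k+1)`-set meeting
the proportionality class `I` of `q_{a₀}` exactly once projects, along `v_{a₀}`, to a linearly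
independent `k`-set. [cite: AgrawalEtAl2011, Lemma 3.1 (proof: "`ℓ_2, ⋯, ℓ_k` remain independent
linear polynomials modulo `ℓ_1`")] locator: paper:arxiv-1111.0582 p0007.txt -/
theorem linearIndependent_proj_sdiff (v : ι → Fin n → K) (a₀ : ι) (i₀ : Fin n) (I L : Finset ι)
    (t : ι → K) (hI : ∀ b ∈ I, t b ≠ 0 ∧ v b = t b • v a₀)
    (hL : LinearIndependent K (fun a : L => v a)) (hcard : (L ∩ I).card = 1) :
    LinearIndependent K (fun a : ↥(L \ I) => v a - (v a i₀ * (v a₀ i₀)⁻¹) • v a₀) := by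
  obtain ⟨b, hb⟩ := Finset.card_eq_one.1 hcard
  have hbL : b ∈ L := (Finset.mem_inter.1 (hb ▸ Finset.mem_singleton_self b)).1
  have hbI : b ∈ I := (Finset.mem_inter.1 (hb ▸ Finset.mem_singleton_self b)).2
  have hins : insert b (L \ I) = L := by
    ext a
    simp only [Finset.mem_insert, Finset.mem_sdiff]
    constructor
    · rintro (rfl | ⟨haL, -⟩)
      · exact hbL
      · exact haL
    · intro haL
      by_cases haI : a ∈ I
      · left
        have : a ∈ L ∩ I := Finset.mem_inter.2 ⟨haL, haI⟩
        rw [hb] at this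
        exact Finset.mem_singleton.1 this
      · exact Or.inr ⟨haL, haI⟩
  have hbnot : b ∉ L \ I := fun h => (Finset.mem_sdiff.1 h).2 hbI
  have hL' : LinearIndependent K (fun a : ↥(insert b (L \ I)) => v a) := by
    rw [hins]
    exact hL
  exact linearIndependent_proj_of_insert v (v a₀) (L \ I) b hbnot i₀ (t b) (hI b hbI).1
    (hI b hbI).2 hL'

/-- **Rank preservation descends to the hyperplane** (the rank-`(k+1)`-preserving property of
`Ψ` modulo `ℓ_1` used in the reverse induction of [ASSS16, Thm. 3.2]): if `·W` preserves the
independence of `≤ k+2` of the `v`'s, then `·W` followed by the projection along `v_{a₀} W`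
preserves the independence of `≤ k+1` projections along `v_{a₀}`. [cite: AgrawalEtAl2011, Thm. 3.2 (proof, §7.2)]
locator: paper:arxiv-1111.0582 p0018.txt -/
theorem rankPreserving_proj (v : ι → Fin n → K) (a₀ : ι) (i₀ : Fin n) (hv₀ : v a₀ i₀ ≠ 0)
    (W : Matrix (Fin n) (Fin μ) K) (b₀ : Fin μ) (hb₀ : Matrix.vecMul (v a₀) W b₀ ≠ 0) (k : ℕ)
    (hRP : ∀ s : Finset ι, s.card ≤ k + 2 → LinearIndependent K (fun a : s => v a) →
      LinearIndependent K (fun a : s => Matrix.vecMul (v a) W))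
    (s : Finset ι) (hs : s.card ≤ k + 1)
    (hLI : LinearIndependent K (fun a : s => v a - (v a i₀ * (v a₀ i₀)⁻¹) • v a₀)) :
    LinearIndependent K (fun a : s =>
      Matrix.vecMul (v a - (v a i₀ * (v a₀ i₀)⁻¹) • v a₀) W -
        (Matrix.vecMul (v a - (v a i₀ * (v a₀ i₀)⁻¹) • v a₀) W b₀ *
          (Matrix.vecMul (v a₀) W b₀)⁻¹) • Matrix.vecMul (v a₀) W) := by
  have ha₀ : a₀ ∉ s := by
    intro h
    have := hLI.ne_zero ⟨a₀, h⟩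
    apply this
    simp [mul_inv_cancel₀ hv₀]
  have h1 := linearIndependent_insert_of_proj v s a₀ ha₀ i₀ hv₀ hLI
  have h2 := hRP (insert a₀ s) (by rw [Finset.card_insert_of_notMem ha₀]; omega) h1
  have h3 := linearIndependent_proj_of_insert (fun a => Matrix.vecMul (v a) W)
    (Matrix.vecMul (v a₀) W) s a₀ ha₀ b₀ 1 one_ne_zero (by rw [one_smul]) h2
  convert h3 using 2 with a
  rw [Matrix.sub_vecMul, Matrix.smul_vecMul]
  set z := Matrix.vecMul (v (a : ι)) W
  set w₁ := Matrix.vecMul (v a₀) W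
  funext j
  simp only [Pi.sub_apply, Pi.smul_apply, smul_eq_mul]
  field_simp
  ring

end Transfer

section Certificate

variable {K : Type*} [Field K] {ι : Type*} [DecidableEq ι] {n μ : ℕ}

/-- **The depth-3 certificate [ASSS16, Lemma 3.1 + Thm. 3.2], abstract form.** Let
`q_a = c_a + Σ_x v_{a,x} X_x` (`a ∈ U`) be affine forms over a field and
`N = Σ_{L ⊆ U, |L| = k} α_L ∏_{a ∈ U∖L} q_a` with `α_L ≠ 0` only when `(v_a)_{a ∈ L}` is linearly
independent — the shape of a `k × k` Jacobian minor of products of linear forms, eq. (1) of §3,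
`H_0 = T · Σ_L α_L / (ℓ_1 ⋯ ℓ_k)`. If an affine substitution `X ↦ u + W·Z` is
*rank-`(k+1)`-preserving* (independent families of `≤ k+1` of the `v_a` stay independent after
`· W`), then `N ≠ 0 ⟹ N(u + W Z) ≠ 0` ("If `Ψ` is a rank-`(k+1)` preserving map for `H_0`, then
`Ψ(H_0) ≠ 0`", Thm. 3.2). Proof by induction on `k` along a certifying path (Lemma 3.1): a form
`q_{a₀}` dividing `N` fewer times than its multiplicity exists by the degree count
(`exists_affine_pow_not_dvd`); modulo `q_{a₀}` (resp. `Ψ(q_{a₀})`, via the hyperplane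
substitutions) `N` is `q_{a₀}^{e-1}` times a sum of the same shape with `k-1` on the hyperplane
(`pow_dvd_sum_sub_pow_mul_sum`, `sum_filter_inter_card_eq_one_eq`), to which the induction
hypothesis applies with the descended rank-preserving map (`rankPreserving_proj`).
[cite: AgrawalEtAl2011, Lemma 3.1 and Thm. 3.2 (proofs §7.2)]
locator: paper:arxiv-1111.0582 p0007.txt:L60–L110, p0017.txt (§7.2), p0018.txt -/
theorem aeval_affine_ne_zero_of_rankPreserving (k : ℕ) :
    ∀ (U : Finset ι) (c : ι → K) (v : ι → Fin n → K) (α : Finset ι → K)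
      (u : Fin n → K) (W : Matrix (Fin n) (Fin μ) K),
      (∀ L, α L ≠ 0 → LinearIndependent K (fun a : ↥L => v a)) →
      (∀ s : Finset ι, s.card ≤ k + 1 → LinearIndependent K (fun a : ↥s => v a) →
        LinearIndependent K (fun a : ↥s => Matrix.vecMul (v a) W)) →
      (∑ L ∈ U.powersetCard k, C (α L) * ∏ a ∈ U \ L, (C (c a) + ∑ x, C (v a x) * X x) :
          MvPolynomial (Fin n) K) ≠ 0 →
      aeval (fun x : Fin n => (C (u x) + ∑ b, C (W x b) * X b : MvPolynomial (Fin μ) K))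
        (∑ L ∈ U.powersetCard k, C (α L) * ∏ a ∈ U \ L, (C (c a) + ∑ x, C (v a x) * X x)) ≠ 0 := by
  induction k with
  | zero =>
    intro U c v α u W hα hRP hN
    rw [Finset.powersetCard_zero, Finset.sum_singleton, Finset.sdiff_empty] at hN ⊢
    rw [map_mul, aeval_C, algebraMap_eq, map_prod]
    have hα0 : α ∅ ≠ 0 := fun h => hN (by rw [h, C_0, zero_mul])
    have hprod := right_ne_zero_of_mul hN
    refine mul_ne_zero (fun h => hα0 ((C_eq_zero).1 h)) (Finset.prod_ne_zero_iff.2 fun a ha => ?_)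
    have hqa := (Finset.prod_ne_zero_iff.1 hprod) a ha
    rw [aeval_affine_affine]
    by_cases hva : v a = 0
    · have hca : c a ≠ 0 := fun h => hqa ((affine_eq_zero_iff _ _).2 ⟨h, hva⟩)
      intro h0
      have h1 := ((affine_eq_zero_iff _ _).1 h0).1
      rw [hva, zero_dotProduct, add_zero] at h1
      exact hca h1
    · have hli : LinearIndependent K (fun x : ↥({a} : Finset ι) => v x) := by
        rw [linearIndependent_finset_iff]
        intro g hg x hx
        rw [Finset.mem_singleton] at hx
        subst hx
        rw [Finset.sum_singleton] at hg
        exact (smul_eq_zero.1 hg).resolve_right hva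
      have h1 := hRP {a} (by simp) hli
      have hne : Matrix.vecMul (v a) W ≠ 0 := h1.ne_zero ⟨a, Finset.mem_singleton_self a⟩
      intro h0
      exact hne ((affine_eq_zero_iff _ _).1 h0).2
  | succ k ih =>
    intro U c v α u W hα hRP hN
    classical
    set Ψ : MvPolynomial (Fin n) K →ₐ[K] MvPolynomial (Fin μ) K :=
      aeval (fun x : Fin n => (C (u x) + ∑ b, C (W x b) * X b : MvPolynomial (Fin μ) K)) with hΨ
    set N : MvPolynomial (Fin n) K := ∑ L ∈ U.powersetCard (k + 1),
      C (α L) * ∏ a ∈ U \ L, (C (c a) + ∑ x, C (v a x) * X x) with hNdef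
    -- (1) a surviving coefficient
    obtain ⟨L₀, hL₀P, hαL₀⟩ : ∃ L₀ ∈ U.powersetCard (k + 1), α L₀ ≠ 0 := by
      by_contra h
      apply hN
      refine Finset.sum_eq_zero fun L hL => ?_
      have : α L = 0 := by
        by_contra h'
        exact h ⟨L, hL, h'⟩
      rw [this, C_0, zero_mul]
    -- the non-constant members
    set NC := U.filter (fun a => v a ≠ 0) with hNCdef
    have hNCmem : ∀ a, a ∈ NC ↔ a ∈ U ∧ v a ≠ 0 := fun a => Finset.mem_filter
    have hLNC : ∀ L ∈ U.powersetCard (k + 1), α L ≠ 0 → L ⊆ NC := by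
      intro L hL hαL a ha
      exact (hNCmem a).2 ⟨(Finset.mem_powersetCard.1 hL).1 ha, (hα L hαL).ne_zero ⟨a, ha⟩⟩
    have hNCcard : k + 1 ≤ NC.card := by
      have := Finset.card_le_card (hLNC L₀ hL₀P hαL₀)
      rw [(Finset.mem_powersetCard.1 hL₀P).2] at this
      exact this
    -- (2) the degree count `deg N ≤ |NC| - (k+1) < |NC|`
    have hdeg : N.totalDegree < NC.card := by
      refine lt_of_le_of_lt (totalDegree_finsetSum _ _) ?_
      rw [Finset.sup_lt_iff (by simp only [bot_eq_zero']; omega)]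
      intro L hL
      by_cases hαL : α L = 0
      · rw [hαL, C_0, zero_mul, totalDegree_zero]
        omega
      refine lt_of_le_of_lt (totalDegree_mul _ _) ?_
      rw [totalDegree_C, zero_add]
      refine lt_of_le_of_lt (totalDegree_finsetProd _ _) ?_
      have hb : ∑ a ∈ U \ L, (C (c a) + ∑ x, C (v a x) * X x : MvPolynomial (Fin n) K).totalDegree ≤
          ((U \ L).filter (fun a => v a ≠ 0)).card := by
        rw [Finset.card_filter]
        refine Finset.sum_le_sum fun a _ => ?_
        by_cases hva : v a = 0
        · rw [if_neg (not_not.2 hva), hva]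
          have : (C (c a) + ∑ x, C ((0 : Fin n → K) x) * X x : MvPolynomial (Fin n) K) = C (c a) := by
            simp
          rw [this, totalDegree_C]
        · rw [if_pos hva]
          exact totalDegree_affine_le _ _
      refine lt_of_le_of_lt hb ?_
      have hsub : (U \ L).filter (fun a => v a ≠ 0) = NC \ L := by
        ext a
        simp only [Finset.mem_filter, Finset.mem_sdiff, hNCmem]
        tauto
      rw [hsub, Finset.card_sdiff_of_subset (hLNC L hL hαL), (Finset.mem_powersetCard.1 hL).2]
      omega
    -- (3) the first element of a certifying path
    obtain ⟨a₀, ha₀U, hva₀, I, hImem, hndvd⟩ := exists_affine_pow_not_dvd U c v NC hNCmem N hN hdeg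
    obtain ⟨i₀, hi₀⟩ : ∃ i₀, v a₀ i₀ ≠ 0 := Function.ne_iff.1 hva₀
    set t : ι → K := fun a => v a i₀ * (v a₀ i₀)⁻¹ with htdef
    have hIU : I ⊆ U := fun b hb => ((hImem b).1 hb).1
    have ha₀I : a₀ ∈ I := (hImem a₀).2 ⟨ha₀U, 1, one_ne_zero, by simp, by simp⟩
    have he : 1 ≤ I.card := Finset.card_pos.2 ⟨a₀, ha₀I⟩
    have hIt : ∀ b ∈ I, t b ≠ 0 ∧ c b = t b * c a₀ ∧ v b = t b • v a₀ := by
      intro b hb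
      obtain ⟨t', ht', hc, hv⟩ := ((hImem b).1 hb).2
      have htb : t b = t' := by
        simp only [htdef, hv, Pi.smul_apply, smul_eq_mul]
        rw [mul_assoc, mul_inv_cancel₀ hi₀, mul_one]
      rw [htb]
      exact ⟨ht', hc, hv⟩
    set q₀ : MvPolynomial (Fin n) K := C (c a₀) + ∑ x, C (v a₀ x) * X x with hq₀
    have hqI : ∀ b ∈ I, (C (c b) + ∑ x, C (v b x) * X x : MvPolynomial (Fin n) K) = C (t b) * q₀ := by
      intro b hb
      obtain ⟨-, hc, hv⟩ := hIt b hb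
      rw [hc, hv, hq₀, mul_add, ← map_mul, Finset.mul_sum]
      congr 1
      refine Finset.sum_congr rfl fun x _ => ?_
      rw [Pi.smul_apply, smul_eq_mul, map_mul, mul_assoc]
    -- (4) two members of `I` in one `L` kill `α_L`
    have hα2 : ∀ L ∈ U.powersetCard (k + 1), 2 ≤ (L ∩ I).card →
        (C (α L) : MvPolynomial (Fin n) K) = 0 := by
      intro L hL h2
      obtain ⟨b, hb, b', hb', hne⟩ := Finset.one_lt_card.1 (by omega : 1 < (L ∩ I).card)
      have hbI := (Finset.mem_inter.1 hb).2
      have hb'I := (Finset.mem_inter.1 hb').2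
      have hdep := not_linearIndependent_of_two_smul v (v a₀) L (Finset.mem_inter.1 hb).1
        (Finset.mem_inter.1 hb').1 hne (hIt b' hb'I).1 (hIt b hbI).2.2 (hIt b' hb'I).2.2
      have hαL : α L = 0 := by
        by_contra h
        exact hdep (hα L h)
      rw [hαL, C_0]
    -- (5) the residue decomposition `N ≡ q₀^{e-1} M (mod q₀^e)`
    set M : MvPolynomial (Fin n) K := ∑ L ∈ (U.powersetCard (k + 1)).filter (fun L => (L ∩ I).card = 1),
      (C (α L) * ∏ a ∈ I \ L, C (t a)) * ∏ a ∈ (U \ I) \ L, (C (c a) + ∑ x, C (v a x) * X x) with hMdef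
    have hD : q₀ ^ I.card ∣ N - q₀ ^ (I.card - 1) * M :=
      pow_dvd_sum_sub_pow_mul_sum U I k (fun a => (C (c a) + ∑ x, C (v a x) * X x : MvPolynomial (Fin n) K))
        q₀ (fun a => C (t a)) (fun L => C (α L)) hIU hqI hα2 he
    -- (6) `q₀ ∤ M`
    have hq₀M : ¬ q₀ ∣ M := by
      intro h
      apply hndvd
      have h1 : q₀ ^ I.card ∣ q₀ ^ (I.card - 1) * M := by
        obtain ⟨M', hM'⟩ := h
        rw [hM', ← mul_assoc, ← pow_succ, Nat.sub_add_cancel he]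
        exact dvd_mul_right _ _
      have := dvd_add hD h1
      rwa [sub_add_cancel] at this
    -- (7) `M` as an instance of size `k` on `U \ I`
    set β : Finset ι → K := fun L' =>
      ∑ L ∈ ((U.powersetCard (k + 1)).filter (fun L => (L ∩ I).card = 1)).filter (fun L => L \ I = L'),
        α L * ∏ a ∈ I \ L, t a with hβdef
    have hMβ : M = ∑ L' ∈ (U \ I).powersetCard k,
        C (β L') * ∏ a ∈ (U \ I) \ L', (C (c a) + ∑ x, C (v a x) * X x) := by
      rw [hMdef, sum_filter_inter_card_eq_one_eq U I k _ (fun L => C (α L) * ∏ a ∈ I \ L, C (t a))]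
      refine Finset.sum_congr rfl fun L' _ => ?_
      congr 1
      simp only [hβdef, map_sum, map_mul, map_prod]
    have hβsupp : ∀ L', β L' ≠ 0 →
        LinearIndependent K (fun a : ↥L' => v a - (v a i₀ * (v a₀ i₀)⁻¹) • v a₀) := by
      intro L' hL'
      obtain ⟨L, hL, hLne⟩ := Finset.exists_ne_zero_of_sum_ne_zero hL'
      rw [Finset.mem_filter, Finset.mem_filter] at hL
      have hαL : α L ≠ 0 := left_ne_zero_of_mul hLne
      rw [← hL.2]
      exact linearIndependent_proj_sdiff v a₀ i₀ I L t (fun b hb => ⟨(hIt b hb).1, (hIt b hb).2.2⟩)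
        (hα L hαL) hL.1.2
    -- (8) the hyperplane substitution `π` killing `q₀`
    set uπ : Fin n → K := fun y => if y = i₀ then -((v a₀ i₀)⁻¹ * c a₀) else 0 with huπ
    set Wπ : Matrix (Fin n) (Fin n) K := Matrix.of fun y y' : Fin n =>
      (if y = y' then (1 : K) else 0) - (if y = i₀ then (v a₀ i₀)⁻¹ * v a₀ y' else 0) with hWπ
    set π : MvPolynomial (Fin n) K →ₐ[K] MvPolynomial (Fin n) K :=
      aeval (fun y : Fin n => (C (uπ y) + ∑ y', C (Wπ y y') * X y' : MvPolynomial (Fin n) K)) with hπdef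
    have hπcong : ∀ G, q₀ ∣ π G - G :=
      dvd_aeval_sub_self _ q₀ (fun y => dvd_aeval_proj_X_sub_X (v a₀) i₀ (c a₀) y)
    have hπM0 : π M ≠ 0 := by
      intro h0
      apply hq₀M
      have := hπcong M
      rwa [h0, zero_sub, dvd_neg] at this
    set c' : ι → K := fun a => c a + v a ⬝ᵥ uπ with hc'
    set v' : ι → Fin n → K := fun a => Matrix.vecMul (v a) Wπ with hv'
    have hv'eq : ∀ a, v' a = v a - (v a i₀ * (v a₀ i₀)⁻¹) • v a₀ := fun a =>
      vecMul_projMatrix (v a₀) i₀ (v a)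
    have hπC : ∀ r : K, π (C r) = C r := fun r => by
      rw [hπdef, aeval_C, algebraMap_eq]
    have hπq : ∀ a, π (C (c a) + ∑ x, C (v a x) * X x) = C (c' a) + ∑ x, C (v' a x) * X x := fun a =>
      aeval_affine_affine uπ Wπ (c a) (v a)
    have hπM : π M = ∑ L' ∈ (U \ I).powersetCard k,
        C (β L') * ∏ a ∈ (U \ I) \ L', (C (c' a) + ∑ x, C (v' a x) * X x) := by
      rw [hMβ, map_sum]
      refine Finset.sum_congr rfl fun L' _ => ?_
      rw [map_mul, hπC, map_prod]
      exact congrArg _ (Finset.prod_congr rfl fun a _ => hπq a)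
    -- (9) `Ψ(q₀)` and the hyperplane substitution `π'` on the target killing it
    set c₁ : K := c a₀ + v a₀ ⬝ᵥ u with hc₁
    set w₁ : Fin μ → K := Matrix.vecMul (v a₀) W with hw₁
    have hΨq₀ : Ψ q₀ = C c₁ + ∑ b, C (w₁ b) * X b := aeval_affine_affine u W (c a₀) (v a₀)
    have hw₁ne : w₁ ≠ 0 := by
      have hli : LinearIndependent K (fun x : ↥({a₀} : Finset ι) => v x) := by
        rw [linearIndependent_finset_iff]
        intro g hg x hx
        rw [Finset.mem_singleton] at hx
        subst hx
        rw [Finset.sum_singleton] at hg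
        exact (smul_eq_zero.1 hg).resolve_right hva₀
      exact (hRP {a₀} (by simp) hli).ne_zero ⟨a₀, Finset.mem_singleton_self a₀⟩
    obtain ⟨b₀, hb₀⟩ : ∃ b₀, w₁ b₀ ≠ 0 := Function.ne_iff.1 hw₁ne
    set uπ' : Fin μ → K := fun y => if y = b₀ then -((w₁ b₀)⁻¹ * c₁) else 0 with huπ'
    set Wπ' : Matrix (Fin μ) (Fin μ) K := Matrix.of fun y y' : Fin μ =>
      (if y = y' then (1 : K) else 0) - (if y = b₀ then (w₁ b₀)⁻¹ * w₁ y' else 0) with hWπ'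
    set π' : MvPolynomial (Fin μ) K →ₐ[K] MvPolynomial (Fin μ) K :=
      aeval (fun y : Fin μ => (C (uπ' y) + ∑ y', C (Wπ' y y') * X y' : MvPolynomial (Fin μ) K))
      with hπ'def
    have hπ'q : π' (Ψ q₀) = 0 := by
      rw [hΨq₀]
      exact aeval_proj_self w₁ b₀ hb₀ c₁
    have hπ'Ψπ : ∀ G, π' (Ψ (π G)) = π' (Ψ G) := by
      intro G
      obtain ⟨H, hH⟩ := hπcong G
      have e : π G = G + q₀ * H := by rw [← hH]; ring
      rw [e, map_add, map_mul, map_add, map_mul, hπ'q, zero_mul, add_zero]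
    -- (10) the composite `π' ∘ Ψ` is the affine substitution `(u', W')`
    set u' : Fin n → K := u + Matrix.mulVec W uπ' with hu'
    set W' : Matrix (Fin n) (Fin μ) K := W * Wπ' with hW'
    have hΨ' : ∀ G, aeval (fun x : Fin n => (C (u' x) + ∑ b, C (W' x b) * X b : MvPolynomial (Fin μ) K)) G =
        π' (Ψ G) := fun G => (aeval_affine_comp u W uπ' Wπ' G).symm
    -- (11) rank preservation descends
    have hRP' : ∀ s : Finset ι, s.card ≤ k + 1 → LinearIndependent K (fun a : ↥s => v' a) →
        LinearIndependent K (fun a : ↥s => Matrix.vecMul (v' a) W') := by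
      intro s hs hli
      have hli' : LinearIndependent K (fun a : ↥s => v a - (v a i₀ * (v a₀ i₀)⁻¹) • v a₀) := by
        simpa only [hv'eq] using hli
      have key := rankPreserving_proj v a₀ i₀ hi₀ W b₀ hb₀ k hRP s hs hli'
      convert key using 2 with a
      rw [hW', ← Matrix.vecMul_vecMul, hWπ', vecMul_projMatrix, hv'eq]
    -- (12) the induction hypothesis on the hyperplane
    have hβsupp' : ∀ L', β L' ≠ 0 → LinearIndependent K (fun a : ↥L' => v' a) := by
      intro L' hL'
      simpa only [hv'eq] using hβsupp L' hL'
    have hih := ih (U \ I) c' v' β u' W' hβsupp' hRP' (by rw [← hπM]; exact hπM0)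
    rw [hΨ', ← hπM, hπ'Ψπ] at hih
    -- (13) `Ψ(q₀) ∤ Ψ(M)`
    have hΨq₀M : ¬ Ψ q₀ ∣ Ψ M := by
      rintro ⟨H, hH⟩
      apply hih
      rw [hH, map_mul, hπ'q, zero_mul]
    -- (14) conclusion
    intro hΨN
    apply hΨq₀M
    obtain ⟨R, hR⟩ := hD
    have hΨq₀ne : Ψ q₀ ≠ 0 := by
      rw [hΨq₀]
      intro h0
      exact hw₁ne ((affine_eq_zero_iff _ _).1 h0).2
    have h1 : Ψ N = Ψ q₀ ^ (I.card - 1) * (Ψ M + Ψ q₀ * Ψ R) := by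
      have h := congrArg Ψ hR
      rw [map_sub, map_mul, map_pow, map_mul, map_pow] at h
      have e : Ψ q₀ ^ I.card = Ψ q₀ ^ (I.card - 1) * Ψ q₀ := by
        rw [← pow_succ, Nat.sub_add_cancel he]
      rw [e] at h
      linear_combination h
    rw [hΨN] at h1
    have h2 : Ψ M + Ψ q₀ * Ψ R = 0 :=
      (mul_eq_zero.1 h1.symm).resolve_left (pow_ne_zero _ hΨq₀ne)
    exact ⟨-Ψ R, by linear_combination h2⟩

end Certificate

end ASSS16

end Literature.Computability.AlgebraicComplexity

end
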